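import Literature.Geometry.Manifold.ClarkeJacobianSemicontinuity
import Literature.Analysis.Convolution.ScaledMollifier
import HarnessLib

/-!
# Derivatives of mollified Lipschitz maps lie near the generalised Jacobian

Topic `Geometry/Manifold`; namespace `Literature.Geometry.Manifold`. Second proof layer under the
named fact `Literature.Geometry.Manifold.KondoTanakaRecognition` (Kondo–Tanaka 2017, Cor. 1.10).
For a Lipschitz map `g : E → F` between finite-dimensional spaces and the mollification
`J_ε g = ρ_ε ⋆ g` of the tree (`Literature.Analysis.Convolution.mollify`, kernel of radii
`(ε, 2ε)`):

* `fderiv_mollify_apply_of_lipschitz`, `fderiv_mollify_of_lipschitz` — **the derivative of the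
  mollification is the mollification of the a.e. derivative**,
  `D(J_ε g)(x) = ∫ ρ_ε(t) Dg(x − t) dt` (Rademacher + differentiation under the integral sign;
  Kondo–Tanaka Lemma 2.3 / (2.18): `(dF_ε^{(p)})_q(u) = ∫ ρ_ε(y) dF_{q(y)}(…) dy`);
* `fderiv_mollify_mem_of_lipschitz` — **Kondo–Tanaka Lemma 2.8**: if `Dg(z)` lies in a closed
  convex set `C` for a.e. `z ∈ B(x, 2ε)`, then `D(J_ε g)(x) ∈ C` (the average of a map with values
  in a closed convex set stays in it — Mathlib's `Convex.integral_mem` for the probability measure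
  `ρ_ε dt`);
* `eventually_fderiv_mollify_mem_cthickening` — **Kondo–Tanaka Lemma 2.10** (chart form): for
  `η > 0`, `D(J_ε g)(x) ∈ ∂g(x₀)_η` (closed `η`-neighbourhood of the generalised Jacobian) for all
  `(ε, x)` close to `(0⁺, x₀)` — from Lemma 2.8 and the upper semicontinuity Lemma 2.9
  (`eventually_fderiv_mem_thickening_clarkeJacobian`);
* `norm_mollify_sub_le_of_lipschitz` — `‖J_ε g(x) − g(x)‖ ≤ 2Lε` (K–T Lemma 2.16).

Everything here is proved; no definitions, no named facts.

## References

* K. Kondo, M. Tanaka, *Approximations of Lipschitz maps via immersions and differentiable exotic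
  sphere theorems*, Nonlinear Anal. 155 (2017) 219–249 (arXiv:1408.6036), Lemmas 2.3, 2.8, 2.9,
  2.10, 2.16. [KondoTanaka2017]
* L. C. Evans, R. F. Gariepy, *Measure theory and fine properties of functions* (1992), §4.2.1,
  Thm. 1 (mollification of Lipschitz / Sobolev functions). [folklore background]
-/

noncomputable section

open scoped Topology NNReal ENNReal Convolution
open Set Function Filter Metric MeasureTheory
open Literature.Analysis.Convolution

namespace Literature.Geometry.Manifold

variable {E : Type*} [NormedAddCommGroup E] [InnerProductSpace ℝ E] [FiniteDimensional ℝ E]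
  [MeasurableSpace E] [BorelSpace E]
  {F : Type*} [NormedAddCommGroup F] [NormedSpace ℝ F] [FiniteDimensional ℝ F]
  [MeasurableSpace F] [BorelSpace F]

omit [MeasurableSpace F] [BorelSpace F] in
/-- The integrand `t ↦ ρ_ε(t) Dg(x − t)` of the mollified derivative is integrable, for `g`
Lipschitz (its a.e. derivative is bounded by the Lipschitz constant). [folklore] -/
theorem integrable_mollifier_smul_fderiv {g : E → F} {K : ℝ≥0} (hg : LipschitzWith K g) (ε : ℝ)
    (x : E) : Integrable (fun t => mollifier ε t • fderiv ℝ g (x - t)) := by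
  have hmeas : AEStronglyMeasurable (fun t => fderiv ℝ g (x - t)) volume :=
    ((measurable_fderiv ℝ g).comp (measurable_const.sub measurable_id)).aestronglyMeasurable
  refine ((integrable_mollifier ε).norm.mul_const K).mono' ((continuous_mollifier ε).aestronglyMeasurable.smul hmeas) ?_
  refine Eventually.of_forall fun t => ?_
  rw [norm_smul]
  exact mul_le_mul_of_nonneg_left (norm_fderiv_le_of_lipschitz ℝ hg) (norm_nonneg _)

/-- **The derivative of a mollified Lipschitz map, applied to a vector**:
`D(J_ε g)(x) a = ∫ ρ_ε(t) Dg(x − t) a dt` — differentiation under the integral sign along the line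
`s ↦ x + s a`, dominated by the Lipschitz bound, the integrand being differentiable in `s` at
`s = 0` for a.e. `t` by Rademacher's theorem. [cite: KondoTanaka2017, Lemma 2.3] -/
theorem fderiv_mollify_apply_of_lipschitz {g : E → F} {K : ℝ≥0} (hg : LipschitzWith K g) (ε : ℝ)
    (x a : E) : fderiv ℝ (mollify ε g) x a = ∫ t, mollifier ε t • fderiv ℝ g (x - t) a := by
  set ρ : ContDiffBump (0 : E) := mollBump E ε with hρ
  set w : E → F := mollify ε g with hw
  have hwdef : w = ρ.normed volume ⋆[ContinuousLinearMap.lsmul ℝ ℝ, volume] g := rfl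
  have hmdef : (mollifier ε : E → ℝ) = ρ.normed volume := rfl
  have hvli : LocallyIntegrable g volume := hg.continuous.locallyIntegrable
  have hwC : ContDiff ℝ 1 w := contDiff_mollify ε hvli
  -- the smooth side: the line derivative of `w` at `x` in the direction `a`
  have hpath : HasDerivAt (fun s : ℝ => x + s • a) a 0 := by
    have h := ((hasDerivAt_id' (0 : ℝ)).smul_const a).const_add x
    rw [one_smul] at h
    exact h
  have h1 : HasDerivAt (fun s : ℝ => w (x + s • a)) (fderiv ℝ w x a) 0 := by
    have hwd : HasFDerivAt w (fderiv ℝ w (x + (0 : ℝ) • a)) (x + (0 : ℝ) • a) :=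
      ((hwC.differentiable one_ne_zero) _).hasFDerivAt
    have h := hwd.comp_hasDerivAt (0 : ℝ) hpath
    rw [zero_smul, add_zero] at h
    exact h
  -- the parametric-integral side
  have hrepr : (fun s : ℝ => w (x + s • a)) =
      fun s : ℝ => ∫ t, ρ.normed volume t • g (x + s • a - t) := by
    funext s
    rw [hwdef]
    exact convolution_lsmul
  have hae : ∀ᵐ t ∂(volume : Measure E), DifferentiableAt ℝ g (x - t) :=
    (Measure.measurePreserving_sub_left volume x).quasiMeasurePreserving.ae
      (hg.ae_differentiableAt (μ := volume))
  have h2 : HasDerivAt (fun s : ℝ => w (x + s • a))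
      (∫ t, ρ.normed volume t • fderiv ℝ g (x - t) a) 0 := by
    rw [hrepr]
    refine (hasDerivAt_integral_of_dominated_loc_of_lip (μ := volume) (x₀ := (0 : ℝ))
      (F := fun (s : ℝ) t => ρ.normed volume t • g (x + s • a - t))
      (F' := fun t => ρ.normed volume t • fderiv ℝ g (x - t) a)
      (bound := fun t => K * ‖a‖ * ρ.normed volume t) univ_mem ?_ ?_ ?_ ?_ ?_ ?_).2
    · refine Eventually.of_forall fun s => ?_
      exact ((ρ.continuous_normed.smul
        (hg.continuous.comp (continuous_const.sub continuous_id))).aestronglyMeasurable :)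
    · simp only [zero_smul, add_zero]
      exact (ρ.continuous_normed.smul (hg.continuous.comp
        (continuous_const.sub continuous_id))).integrable_of_hasCompactSupport
        ρ.hasCompactSupport_normed.smul_right
    · exact ρ.continuous_normed.aestronglyMeasurable.smul
        (((measurable_fderiv_apply_const ℝ g a).comp
          (measurable_const.sub measurable_id)).aestronglyMeasurable :)
    · refine Eventually.of_forall fun t => ?_
      refine (LipschitzWith.of_dist_le_mul fun s s' => ?_).lipschitzOnWith
      have hK' : ((Real.nnabs ((K : ℝ) * ‖a‖ * ρ.normed volume t) : ℝ≥0) : ℝ) =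
          K * ‖a‖ * ρ.normed volume t := by
        rw [Real.coe_nnabs, abs_of_nonneg (mul_nonneg (by positivity) (ρ.nonneg_normed t))]
      rw [hK', dist_eq_norm, ← smul_sub, norm_smul, Real.norm_of_nonneg (ρ.nonneg_normed t),
        Real.dist_eq]
      calc ρ.normed volume t * ‖g (x + s • a - t) - g (x + s' • a - t)‖
          ≤ ρ.normed volume t * (K * ‖(x + s • a - t) - (x + s' • a - t)‖) :=
            mul_le_mul_of_nonneg_left (hg.norm_sub_le _ _) (ρ.nonneg_normed t)
        _ = K * ‖a‖ * ρ.normed volume t * |s - s'| := by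
            rw [show x + s • a - t - (x + s' • a - t) = (s - s') • a by rw [sub_smul]; abel,
              norm_smul, Real.norm_eq_abs]
            ring
    · exact ρ.integrable_normed.const_mul (K * ‖a‖)
    · filter_upwards [hae] with t ht
      have hpath' : HasDerivAt (fun s : ℝ => x + s • a - t) a 0 := hpath.sub_const t
      have hcomp := ht.hasFDerivAt.comp_hasDerivAt_of_eq (0 : ℝ) hpath' (by simp)
      exact hcomp.const_smul (ρ.normed volume t)
  exact h1.unique h2

/-- **The derivative of a mollified Lipschitz map is the mollification of its a.e. derivative**:
`D(J_ε g)(x) = ∫ ρ_ε(t) Dg(x − t) dt` as continuous linear maps. [cite: KondoTanaka2017, Lemma 2.3] -/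
theorem fderiv_mollify_of_lipschitz {g : E → F} {K : ℝ≥0} (hg : LipschitzWith K g) (ε : ℝ)
    (x : E) : fderiv ℝ (mollify ε g) x = ∫ t, mollifier ε t • fderiv ℝ g (x - t) := by
  ext a
  rw [ContinuousLinearMap.integral_apply (integrable_mollifier_smul_fderiv hg ε x) a,
    fderiv_mollify_apply_of_lipschitz hg ε x a]
  rfl

/-- **Kondo–Tanaka Lemma 2.8** (averages stay in closed convex sets), for the derivative of a
mollified Lipschitz map: if `Dg(z) ∈ C` for a.e. differentiability point `z ∈ B(x, 2ε)` and `C`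
is closed and convex, then `D(J_ε g)(x) ∈ C` (`ρ_ε dt` is a probability measure carried by
`B(0, 2ε)`). [cite: KondoTanaka2017, Lemma 2.8] -/
theorem fderiv_mollify_mem_of_lipschitz {g : E → F} {K : ℝ≥0} (hg : LipschitzWith K g) {ε : ℝ}
    (hε : 0 < ε) {x : E} {C : Set (E →L[ℝ] F)} (hC : Convex ℝ C) (hCc : IsClosed C)
    (hmem : ∀ᵐ z ∂(volume : Measure E), z ∈ ball x (2 * ε) → DifferentiableAt ℝ g z →
      fderiv ℝ g z ∈ C) :
    fderiv ℝ (mollify ε g) x ∈ C := by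
  -- the probability measure `ρ_ε dt`
  set d : E → ℝ≥0 := fun t => Real.toNNReal (mollifier ε t) with hd
  have hdm : Measurable d := (continuous_mollifier ε).measurable.real_toNNReal
  have hdcoe : ∀ t, ((d t : ℝ≥0) : ℝ) = mollifier ε t := fun t =>
    Real.coe_toNNReal _ (mollifier_nonneg ε t)
  set ν : Measure E := volume.withDensity fun t => (d t : ℝ≥0∞) with hν
  have hdi : Integrable (fun t => ((d t : ℝ≥0) : ℝ)) (volume : Measure E) :=
    (integrable_mollifier ε).congr (Eventually.of_forall fun t => (hdcoe t).symm)
  haveI : IsProbabilityMeasure ν := by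
    constructor
    rw [hν, withDensity_apply _ MeasurableSet.univ, Measure.restrict_univ,
      lintegral_coe_eq_integral _ hdi, ENNReal.ofReal_eq_one]
    simp_rw [hdcoe]
    exact integral_mollifier ε
  -- the derivative as a `ν`-average
  set G : E → E →L[ℝ] F := fun t => fderiv ℝ g (x - t) with hG
  have hGm : Measurable G := (measurable_fderiv ℝ g).comp (measurable_const.sub measurable_id)
  have hrepr : fderiv ℝ (mollify ε g) x = ∫ t, G t ∂ν := by
    rw [fderiv_mollify_of_lipschitz hg ε x, hν, integral_withDensity_eq_integral_smul hdm]
    refine integral_congr_ae (Eventually.of_forall fun t => ?_)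
    simp only [hG, NNReal.smul_def, hdcoe]
  rw [hrepr]
  refine hC.integral_mem hCc ?_ ?_
  · -- a.e. membership: the density is carried by `B(0, 2ε)`, and `g` is a.e. differentiable
    rw [hν, ae_withDensity_iff hdm.coe_nnreal_ennreal]
    have hae : ∀ᵐ t ∂(volume : Measure E), DifferentiableAt ℝ g (x - t) :=
      (Measure.measurePreserving_sub_left volume x).quasiMeasurePreserving.ae
        (hg.ae_differentiableAt (μ := volume))
    have hmem' : ∀ᵐ t ∂(volume : Measure E), x - t ∈ ball x (2 * ε) →
        DifferentiableAt ℝ g (x - t) → fderiv ℝ g (x - t) ∈ C :=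
      (Measure.measurePreserving_sub_left volume x).quasiMeasurePreserving.ae hmem
    filter_upwards [hae, hmem'] with t ht ht' hdt
    refine ht' ?_ ht
    have hsupp : t ∈ support (mollifier ε : E → ℝ) := by
      intro h0
      apply hdt
      simp [hd, h0]
    rw [support_mollifier hε] at hsupp
    rw [mem_ball, dist_eq_norm, sub_sub_cancel_left, norm_neg]
    exact mem_ball_zero_iff.1 hsupp
  · refine (integrable_const (K : ℝ)).mono' hGm.aestronglyMeasurable
      (Eventually.of_forall fun t => ?_)
    exact norm_fderiv_le_of_lipschitz ℝ hg

/-- **Kondo–Tanaka Lemma 2.10** (chart form): for `g` Lipschitz between finite-dimensional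
spaces and `η > 0`, the derivative `D(J_ε g)(x)` lies in the closed `η`-neighbourhood of the
generalised Jacobian `∂g(x₀)` for all `(ε, x)` sufficiently close to `(0⁺, x₀)` (Lemma 2.8
applied on a ball where, by the upper semicontinuity Lemma 2.9, `Dg` lies `η`-close to `∂g(x₀)`).
[cite: KondoTanaka2017, Lemma 2.10] -/
theorem eventually_fderiv_mollify_mem_cthickening {g : E → F} {K : ℝ≥0} (hg : LipschitzWith K g)
    (x₀ : E) {η : ℝ} (hη : 0 < η) :
    ∀ᶠ p : ℝ × E in (𝓝[>] (0 : ℝ)) ×ˢ 𝓝 x₀,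
      fderiv ℝ (mollify p.1 g) p.2 ∈ cthickening η (clarkeJacobian g x₀) := by
  -- the neighbourhood where the a.e. derivatives are `η`-close to `∂g(x₀)`
  have hgon : LipschitzOnWith K g univ := lipschitzOnWith_univ.2 hg
  have husc : ∀ᶠ z in 𝓝 x₀, DifferentiableAt ℝ g z →
      fderiv ℝ g z ∈ thickening η (clarkeJacobian g x₀) :=
    eventually_fderiv_mem_thickening_clarkeJacobian univ_mem hgon hη
  obtain ⟨δ, hδ, hball⟩ := Metric.eventually_nhds_iff_ball.1 husc
  have hδ4 : (0 : ℝ) < δ / 4 := by positivity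
  have hε : Ioo (0 : ℝ) (δ / 4) ∈ 𝓝[>] (0 : ℝ) := Ioo_mem_nhdsGT hδ4
  have hx : ball x₀ (δ / 2) ∈ 𝓝 x₀ := ball_mem_nhds _ (by positivity)
  filter_upwards [Filter.prod_mem_prod hε hx] with p hp
  obtain ⟨⟨hp1, hp1'⟩, hp2⟩ := hp
  have hC : Convex ℝ (cthickening η (clarkeJacobian g x₀)) :=
    (convex_clarkeJacobian (f := g) (x := x₀)).cthickening η
  refine fderiv_mollify_mem_of_lipschitz (x := p.2) hg hp1 hC isClosed_cthickening ?_
  refine Eventually.of_forall fun z hz hd => ?_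
  have hzx : z ∈ ball x₀ δ := by
    rw [mem_ball] at hz hp2 ⊢
    linarith [dist_triangle z p.2 x₀]
  exact thickening_subset_cthickening η _ (hball z hzx hd)

omit [MeasurableSpace F] [BorelSpace F] in
/-- **`‖J_ε g(x) − g(x)‖ ≤ L · 2ε`** for an `L`-Lipschitz map (Kondo–Tanaka Lemma 2.16: the
mollification at scale `ε` is uniformly `ε L(F) L(exp)`-close). [cite: KondoTanaka2017, Lemma 2.16] -/
theorem norm_mollify_sub_le_of_lipschitz {g : E → F} {K : ℝ≥0} (hg : LipschitzWith K g) {ε : ℝ}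
    (hε : 0 < ε) (x : E) : ‖mollify ε g x - g x‖ ≤ K * (2 * ε) := by
  rw [← dist_eq_norm]
  refine dist_mollify_le hε hg.continuous.aestronglyMeasurable fun y hy => ?_
  exact (hg.dist_le_mul y x).trans (mul_le_mul_of_nonneg_left (mem_ball.1 hy).le K.coe_nonneg)

end Literature.Geometry.Manifold

end
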